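import Literature.Probability.Process.HittingFrom
import HarnessLib

/-!
# Hitting and avoidance events of continuous-path processes are measurable

Topic `Probability/Process`; theorems only. Let `Φ : ℝ≥0 → X → E` be a family of measurable maps
from a measurable space `X` to a (pseudo)metric space `E` — a "process" read on an arbitrary sample
or parameter space `X` — and consider, for a closed `K`, an open `O` and times `a ≤ i`, the events

  `{x | ∃ s ∈ [a, i], Φ s x ∈ K}`  (hitting `K` during `[a, i]`),
  `{x | ∀ s ≤ i, Φ s x ∉ O}`       (avoiding `O` up to time `i`).

They are uncountable unions/intersections, but along CONTINUOUS paths they have countable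
descriptions (density of a countable set of times, compactness of `[0, i]`; the hitting case is the
tree's `exists_mem_Icc_mem_iff_forall_exists_infDist_lt` of `HittingFrom`). We record:

* `exists_measurableSet_iff_exists_mem`, `exists_measurableSet_iff_forall_notMem` — there is a
  measurable `S ⊆ X` which coincides with the event on every `x` whose path `s ↦ Φ s x` is
  continuous (the form needed on raw path spaces, where only almost every path is continuous, e.g.
  to transport such events along equalities of laws);
* `measurableSet_exists_mem`, `measurableSet_forall_notMem` — if all paths are continuous, the
  events themselves are measurable.

Typical `X`: a probability space carrying a continuous process, or its product with a space of
starting points (joint measurability in the starting point is then free).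

## References

* D. Revuz, M. Yor, *Continuous Martingales and Brownian Motion* (1999), Ch. I, §4, proof of
  Prop. (4.6) (countable description of hitting events). [folklore]
-/

noncomputable section

open MeasureTheory Filter Topology Set Metric
open scoped NNReal

namespace Literature.Probability.Process

variable {X E : Type*} [MeasurableSpace X] [PseudoMetricSpace E] [MeasurableSpace E]
  [OpensMeasurableSpace E]

/-- **Hitting a closed set during `[a, i]` is measurable along continuous paths.** For measurable
`Φ s : X → E` (`s : ℝ≥0`), a closed `K` and `a i : ℝ≥0` there is a measurable `S ⊆ X` such that for
every `x` with continuous path, `x ∈ S ↔ ∃ s ∈ [a, i], Φ s x ∈ K`. [folklore] -/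
theorem exists_measurableSet_iff_exists_mem (Φ : ℝ≥0 → X → E) (hΦ : ∀ s, Measurable (Φ s))
    {K : Set E} (hK : IsClosed K) (a i : ℝ≥0) :
    ∃ S : Set X, MeasurableSet S ∧
      ∀ x, Continuous (fun s ↦ Φ s x) → (x ∈ S ↔ ∃ s, a ≤ s ∧ s ≤ i ∧ Φ s x ∈ K) := by
  rcases K.eq_empty_or_nonempty with rfl | hne
  · exact ⟨∅, MeasurableSet.empty, fun x _ ↦ by simp⟩
  obtain ⟨D, hDc, hDd⟩ := TopologicalSpace.exists_countable_dense (Iic i)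
  refine ⟨⋂ n : ℕ, ⋃ q ∈ insert (⟨i, mem_Iic.2 le_rfl⟩ : Iic i) D,
      {x | a ≤ (q : ℝ≥0) ∧ infDist (Φ (q : ℝ≥0) x) K < 1 / ((n : ℝ) + 1)}, ?_, fun x hx ↦ ?_⟩
  · refine MeasurableSet.iInter fun n ↦ MeasurableSet.biUnion (hDc.insert _) fun q _ ↦ ?_
    by_cases hq : a ≤ (q : ℝ≥0)
    · have : {x : X | a ≤ (q : ℝ≥0) ∧ infDist (Φ (q : ℝ≥0) x) K < 1 / ((n : ℝ) + 1)} =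
          {x | infDist (Φ (q : ℝ≥0) x) K < 1 / ((n : ℝ) + 1)} := by
        ext x; simp [hq]
      rw [this]
      exact measurableSet_lt ((continuous_infDist_pt K).measurable.comp (hΦ _)) measurable_const
    · have : {x : X | a ≤ (q : ℝ≥0) ∧ infDist (Φ (q : ℝ≥0) x) K < 1 / ((n : ℝ) + 1)} = ∅ := by
        ext x; simp [hq]
      rw [this]
      exact MeasurableSet.empty
  · -- the countable description along the continuous path of `x`
    have key := exists_mem_Icc_mem_iff_forall_exists_infDist_lt (u := fun t (x : X) ↦ Φ t x)
      (T := fun _ ↦ ((a : ℝ≥0) : WithTop ℝ≥0)) (ω := x) hK hne hx hDd (i := i)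
    simp only [mem_iInter, mem_iUnion, mem_setOf_eq, exists_prop]
    constructor
    · intro h
      have h' : ∃ j ≤ i, ((a : ℝ≥0) : WithTop ℝ≥0) ≤ j ∧ Φ j x ∈ K :=
        key.2 fun n ↦ by
          obtain ⟨q, hq, hqa, hqd⟩ := h n
          exact ⟨q, hq, WithTop.coe_le_coe.2 hqa, hqd⟩
      obtain ⟨j, hji, haj, hj⟩ := h'
      exact ⟨j, WithTop.coe_le_coe.1 haj, hji, hj⟩
    · rintro ⟨s, has, hsi, hs⟩ n
      obtain ⟨q, hq, hqa, hqd⟩ := key.1 ⟨s, hsi, WithTop.coe_le_coe.2 has, hs⟩ n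
      exact ⟨q, hq, WithTop.coe_le_coe.1 hqa, hqd⟩

/-- **Avoiding an open set up to time `i` is measurable along continuous paths.** For measurable
`Φ s : X → E`, an open `O` and `i : ℝ≥0` there is a measurable `S ⊆ X` such that for every `x` with
continuous path, `x ∈ S ↔ ∀ s ≤ i, Φ s x ∉ O`. [folklore] -/
theorem exists_measurableSet_iff_forall_notMem (Φ : ℝ≥0 → X → E) (hΦ : ∀ s, Measurable (Φ s))
    {O : Set E} (hO : IsOpen O) (i : ℝ≥0) :
    ∃ S : Set X, MeasurableSet S ∧ ∀ x, Continuous (fun s ↦ Φ s x) → (x ∈ S ↔ ∀ s ≤ i, Φ s x ∉ O) := by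
  obtain ⟨D, hDc, hDd⟩ := TopologicalSpace.exists_countable_dense (Iic i)
  refine ⟨⋂ q ∈ D, {x | Φ (q : ℝ≥0) x ∉ O}, ?_, fun x hx ↦ ?_⟩
  · exact MeasurableSet.biInter hDc fun q _ ↦ (hO.measurableSet.preimage (hΦ _)).compl
  · simp only [mem_iInter, mem_setOf_eq]
    constructor
    · intro h s hsi hs
      -- the open set of times `≤ i` at which the path is in `O` meets `D`
      have hcont : Continuous fun q : Iic i ↦ Φ (q : ℝ≥0) x := hx.comp continuous_subtype_val
      have hopen : IsOpen {q : Iic i | Φ (q : ℝ≥0) x ∈ O} := hO.preimage hcont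
      obtain ⟨q, hq1, hq2⟩ := hDd.inter_open_nonempty _ hopen ⟨⟨s, mem_Iic.2 hsi⟩, hs⟩
      exact h q hq2 hq1
    · intro h q _
      exact h q q.2

/-- **Hitting events of continuous-path processes are measurable**: if every path `s ↦ Φ s x` is
continuous, `{x | ∃ s ∈ [a, i], Φ s x ∈ K}` is measurable for closed `K`. [folklore] -/
theorem measurableSet_exists_mem {Φ : ℝ≥0 → X → E} (hΦ : ∀ s, Measurable (Φ s))
    (hc : ∀ x, Continuous fun s ↦ Φ s x) {K : Set E} (hK : IsClosed K) (a i : ℝ≥0) :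
    MeasurableSet {x | ∃ s, a ≤ s ∧ s ≤ i ∧ Φ s x ∈ K} := by
  obtain ⟨S, hS, hiff⟩ := exists_measurableSet_iff_exists_mem Φ hΦ hK a i
  have : {x | ∃ s, a ≤ s ∧ s ≤ i ∧ Φ s x ∈ K} = S := by
    ext x; exact (hiff x (hc x)).symm
  rw [this]; exact hS

/-- **Avoidance events of continuous-path processes are measurable**: if every path is continuous,
`{x | ∀ s ≤ i, Φ s x ∉ O}` is measurable for open `O`. [folklore] -/
theorem measurableSet_forall_notMem {Φ : ℝ≥0 → X → E} (hΦ : ∀ s, Measurable (Φ s))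
    (hc : ∀ x, Continuous fun s ↦ Φ s x) {O : Set E} (hO : IsOpen O) (i : ℝ≥0) :
    MeasurableSet {x | ∀ s ≤ i, Φ s x ∉ O} := by
  obtain ⟨S, hS, hiff⟩ := exists_measurableSet_iff_forall_notMem Φ hΦ hO i
  have : {x | ∀ s ≤ i, Φ s x ∉ O} = S := by
    ext x; exact (hiff x (hc x)).symm
  rw [this]; exact hS

/-- Hitting events from time `0`: `{x | ∃ s ≤ i, Φ s x ∈ K}` is measurable (closed `K`, continuous
paths). [folklore] -/
theorem measurableSet_exists_le_mem {Φ : ℝ≥0 → X → E} (hΦ : ∀ s, Measurable (Φ s))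
    (hc : ∀ x, Continuous fun s ↦ Φ s x) {K : Set E} (hK : IsClosed K) (i : ℝ≥0) :
    MeasurableSet {x | ∃ s ≤ i, Φ s x ∈ K} := by
  have : {x | ∃ s ≤ i, Φ s x ∈ K} = {x | ∃ s, 0 ≤ s ∧ s ≤ i ∧ Φ s x ∈ K} := by
    ext x
    simp only [mem_setOf_eq, zero_le, true_and]
  rw [this]
  exact measurableSet_exists_mem hΦ hc hK 0 i

end Literature.Probability.Process

end
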